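import Summits.PneNP.PneNP.Theorems.ChebyshevTracialDesignTightFreeLayers
import HarnessLib

/-!
# Cell pnp-psdrank, route `ChebyshevTracialDesign`: the layer correlations of the tightness identity in BI-MODE form — odd layers vanish,
# even layers are `(t−2κ)!·c_κ·Σ_{M∈Y} Π_p(M)`, and the Parseval dictionary to `kernelEigen`

Harmonic backbone of the crux `TracialDecayExp20` (stmt-PneNP-19878), brick 26 (prover g7; second input of the S4/SNT work order, MEMO-9 §6).
With `T_j(X,Y) = Σ_{M∈Y} Σ_{|U|=t} ((Wᵀ)^{t−j}p_j)(U)·1[cc(U,M) = 1]` the layer correlations of brick 25 (`…TightFreeLayers.tightFree_layer_identity`: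
tight-free ⇒ `μ·N_1·|Y| + Σ_{j≥1} T_j = 0`), `t = 2a+1`:
* `layerCorr_eq_zero_of_odd` — `T_j = 0` for odd `j` (the tight incidence is blind to odd Johnson layers, `…TightColumnSums`);
* `layerCorr_even_eq` — `T_{2κ} = (t−2κ)!·(n−2a−2κ)·C(n/2−2κ, a−κ)·Σ_{M∈Y} Π_p(M)` with the matching-side functional
  `Π_p(M) = Σ_{T : #{x∈T : partner_M x ∈ T} = 2κ} p_T` of the cell's files (`…RectangleBiMode`, lit `HomogeneousMatchingFamilies.pmatch_closedSum_sq_le`);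
* `closedSum_sq_dictionary` — `((t−2κ)!·(n−2a−2κ)·C(n/2−2κ,a−κ))² · Σ_{M∈PM_n} Π_p(M)² = kernelEigen n t (2κ) κ_1 · ⟪(Wᵀ)^{t−2κ}p, (Wᵀ)^{t−2κ}p⟫`
  (lit `sum_sq_gram_ladder`), the normalisation that converts (F2)'s right-hand side `|PM|·Σ_M Π_p(M)²` into the tight kernel's ladder eigenvalue
  (attenuation `λ_{2κ}(1) = λ₀(1)·Π_{i<κ}(2i+1)/(n−2i)`, `…TightEvenProduct`).
So SNT (S4) = brick 25 + this file + (F1) `SliceLevelInequality.slice_layer_sq_le_log_balanced` (PROVED) + (F2) `pmatch_closedSum_sq_le`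
(conditional on `GlobalLevelDInequality`) + the series arithmetic of p1 N2 §SNT (1) / lit g13 N-a. [cite: Rothvoss2017, §2 (PDF p. 6)]
[cite: BrouwerHaemers2012, Prop. 4.3.2 (PDF p. 83)] [cite: MacWilliamsSloane1977, Ch. 21 §6 Thm. 10 (PDF p. 516)]
Stature: support/instrument. WHAT THIS IS NOT: not SNT, nothing on psd rank, no P-vs-NP content. Supports stmt-PneNP-19878.
-/

set_option linter.dupNamespace false -- `Summit.PneNP.PneNP.…`: summit = sub-problem (D-0017)

noncomputable section

namespace Summit.PneNP.PneNP.Theorems.ChebyshevTracialDesignTightLayerBimode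

open Finset Literature.Barriers.PneNP Literature.Combinatorics.Optimization
open Literature.Combinatorics.AssociationSchemes Literature.Combinatorics.AssociationSchemes.JohnsonHarmonics
open Literature.Combinatorics.AssociationSchemes.JohnsonSpectrum
open Summit.PneNP.PneNP.Theorems.ChebyshevTracialDesignTightColumnSums
open Summit.PneNP.PneNP.Theorems.ChebyshevTracialDesignTightFreeSpectral

variable {n : ℕ}

/-- A column of the tight incidence against a ladder vector is `(t−j)!` times the tight column sum of `zeta p` in the route's
`OddSet` vocabulary. -/
theorem col_ladder_eq_factorial_mul_tightSum {t j : ℕ} (ht : Odd t) (hjt : j ≤ t) (M : PMatch n)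
    {p : Finset (Fin n) → ℝ} (hp : IsHarmonic j p) :
    ∑ U ∈ univ.powersetCard t, (up^[t - j] p) U * (if (U.filter fun x => M.2.partner x ∉ U).card = 1 then (1 : ℝ) else 0) =
      ((t - j).factorial : ℝ) * ∑ U ∈ univ.filter (fun U : OddSet n => U.1.card = t ∧ cc U M = 1), zeta p U.1 := by
  classical
  rw [sum_tight_oddSet_eq M ht, sum_filter, mul_sum]
  refine sum_congr rfl fun U hU => ?_
  rw [ladder_apply_eq_factorial_mul_zeta hjt hp.1 (mem_powersetCard.1 hU).2]
  split_ifs <;> simp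

/-- **Odd layer correlations vanish**: for `t` odd, `j ≤ t` odd and `p` harmonic of degree `j`,
`Σ_{M∈Y} Σ_{|U|=t} ((Wᵀ)^{t−j}p)(U)·1[#cr(U,M) = 1] = 0`. [cite: Rothvoss2017, §2 (PDF p. 6)] -/
theorem layerCorr_eq_zero_of_odd {t j : ℕ} (ht : Odd t) (hj : Odd j) (hjt : j ≤ t) (Y : Finset (PMatch n))
    {p : Finset (Fin n) → ℝ} (hp : IsHarmonic j p) :
    ∑ M ∈ Y, ∑ U ∈ univ.powersetCard t,
      (up^[t - j] p) U * (if (U.filter fun x => M.2.partner x ∉ U).card = 1 then (1 : ℝ) else 0) = 0 :=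
  sum_eq_zero fun M _ => by
    rw [col_ladder_eq_factorial_mul_tightSum ht hjt M hp, tight_column_sum_eq_zero_of_odd M ht hj hp, mul_zero]

/-- **Even layer correlations in bi-mode form**: for `t = 2a+1`, `κ ≤ a`, `4κ ≤ n` and `p` harmonic of degree `2κ`,
`Σ_{M∈Y} Σ_{|U|=t} ((Wᵀ)^{t−2κ}p)(U)·1[#cr(U,M) = 1] = (t−2κ)!·(n−2a−2κ)·C(n/2−2κ, a−κ)·Σ_{M∈Y} Σ_{T : #{x∈T : partner_M x ∈ T} = 2κ} p_T`.
[cite: Rothvoss2017, §2 (PDF p. 6)] -/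
theorem layerCorr_even_eq {a κ : ℕ} (hκn : 4 * κ ≤ n) (hκa : κ ≤ a) (Y : Finset (PMatch n))
    {p : Finset (Fin n) → ℝ} (hp : IsHarmonic (2 * κ) p) :
    ∑ M ∈ Y, ∑ U ∈ univ.powersetCard (2 * a + 1),
      (up^[2 * a + 1 - 2 * κ] p) U * (if (U.filter fun x => M.2.partner x ∉ U).card = 1 then (1 : ℝ) else 0) =
      ((2 * a + 1 - 2 * κ).factorial : ℝ) * (((n : ℝ) - (2 * a : ℕ) - (2 * κ : ℕ)) * (((n / 2 - 2 * κ).choose (a - κ) : ℕ) : ℝ)) *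
        ∑ M ∈ Y, ∑ T ∈ univ.filter (fun T : Finset (Fin n) => (T.filter fun x => M.2.partner x ∈ T).card = 2 * κ), p T := by
  rw [mul_sum]
  refine sum_congr rfl fun M _ => ?_
  rw [col_ladder_eq_factorial_mul_tightSum ⟨a, rfl⟩ (by omega) M hp, tight_column_sum_eq_of_even M hκn hκa hp]
  ring

/-- **The Parseval dictionary for the matching-side functional.** For `t = 2a+1`, `κ ≤ a`, `4κ ≤ n`, `p` harmonic of degree `2κ` and `κ_1` the
Gram class function of the tight incidence on the `t`-sets:
`((t−2κ)!·(n−2a−2κ)·C(n/2−2κ,a−κ))² · Σ_{M ∈ PM_n} Π_p(M)² = kernelEigen n t (2κ) κ_1 · ⟪(Wᵀ)^{t−2κ}p, (Wᵀ)^{t−2κ}p⟫`.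
[cite: MacWilliamsSloane1977, Ch. 21 §6 Thm. 10 with Problem (11) (PDF p. 516)] -/
theorem closedSum_sq_dictionary {a κ : ℕ} (hκn : 4 * κ ≤ n) (hκa : κ ≤ a) {p : Finset (Fin n) → ℝ} (hp : IsHarmonic (2 * κ) p)
    (κ₁ : ℕ → ℝ)
    (hA1 : ∀ U ∈ univ.powersetCard (2 * a + 1), ∀ U' ∈ univ.powersetCard (2 * a + 1),
      ∑ M : PMatch n, (if (U.filter fun x => M.2.partner x ∉ U).card = 1 then (1 : ℝ) else 0) *
        (if (U'.filter fun x => M.2.partner x ∉ U').card = 1 then (1 : ℝ) else 0) = κ₁ (U ∩ U').card) :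
    (((2 * a + 1 - 2 * κ).factorial : ℝ) * (((n : ℝ) - (2 * a : ℕ) - (2 * κ : ℕ)) * (((n / 2 - 2 * κ).choose (a - κ) : ℕ) : ℝ))) ^ 2 *
        ∑ M : PMatch n, (∑ T ∈ univ.filter (fun T : Finset (Fin n) => (T.filter fun x => M.2.partner x ∈ T).card = 2 * κ), p T) ^ 2 =
      kernelEigen n (2 * a + 1) (2 * κ) κ₁ * ip (up^[2 * a + 1 - 2 * κ] p) (up^[2 * a + 1 - 2 * κ] p) := by
  have hgram := sum_sq_gram_ladder (by omega : 2 * κ ≤ 2 * a + 1)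
    (fun U (M : PMatch n) => if (U.filter fun x => M.2.partner x ∉ U).card = 1 then (1 : ℝ) else 0) κ₁ hA1 hp
  rw [← hgram, mul_sum]
  refine sum_congr rfl fun M _ => ?_
  have hM := layerCorr_even_eq hκn hκa ({M} : Finset (PMatch n)) hp
  rw [sum_singleton, sum_singleton] at hM
  rw [hM]
  ring

end Summit.PneNP.PneNP.Theorems.ChebyshevTracialDesignTightLayerBimode
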